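import Summits.AtomisticToContinuum.Crystallization.Theorems.ChartedZeroExcessLayeredLatticeLiouvilleXL

/-!
# Zero-excess layered lattice Liouville — part XM (lens-2 g59, node «SBGlueC4a»): the constants of the tower and the scalar profile step

Critic rows 1133/1135 (C4 «iterate with re-charting and explicit constants; the contraction hypothesis `θ₀ = 8·C_L·t_C² ≤ 1/8`»), leaf (2)
`SubWindowBudgetGlueBPG` of `stmt-AtomisticToContinuum-26636`.  This part is PURE REAL ARITHMETIC — no configurations:

* XM.1 `SBK`: the record of the tower's constants (`δ a Cg η R`; the certificate floor `c₀ C₁ κ₀` of (hU♭); `CL κ₁` of (LD)/(HC) via XD `floor_packages`; `CT` of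
  (PF); the contraction `tC`, the window constant `Kw`, the history lag `k₀`, the top-window ratio `KR`; `εf ε ϱ AT m₀ CR n₁` of (I4ˢ)/(RC)/(LD); the coherence
  thresholds `ϑ₁ ω₁`; the profile `P₀ G₀`, the drift cap `μM`, the far budget `Θa Θb`, the finest window `nlo`) and its DERIVED quantities: `θ₀ = 8·CL·tC²`,
  `θ₁ = 2θ₀`, `rN = 27/tC³`, `Rhist = 27Kw³/tC^{3(k₀+1)}`, `Cm = CL(2+2CL)(2rN + tC⁻²)`, the levels `n ℓ = n0·tC^ℓ` (`n0 = R/KR`), the PROFILE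
  `p ℓ = P₀θ₁^ℓ + G₀/(n ℓ)²`, the E3 radii `t ℓ = 7C₁·n ℓ + 8ϱ + 10`, `τ ℓ = 2·t ℓ`, the comparison window `mw ℓ`, `dA = dictA(c₀/2) 9`, `dAϱ`, the coherence
  slack `δs`, the history coefficient `γ`, the far-field coefficient `G₁`, `Θ ℓ = Θa + Θb/(n ℓ)²`, `pmax`, and the partial drift sums `μpart`.
* XM.2 `SBK.OK`: EVERY inequality among the constants that the tower uses (positivity; ★ the CONTRACTION HYPOTHESIS `θ₀ ≤ 1/8`; `Kw·tC^k₀ ≤ 1`; the history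
  smallness `γ·Rhist·(2 + 216k₀²Cm) ≤ θ₁^{k₀+1}/8` (bought by `εf`, `δs`); the far-field balance `16tC²G₁Θa ≤ G₀`, `16tC²G₁Θb ≤ G₀·nlo²`; the correction smallness
  `1728·Cm·ε² ≤ θ₁`, `1728·CR²Cm²·pmax ≤ θ₁`, `Cm·pmax ≤ m₀²`, `CR√(Cm·pmax) + ε ≤ 1`; the DRIFT BUDGET `CR·μM ≤ min(c₀/2, κ₀/2, C₁, 1/50, 1/2000)`, `2μM ≤ c₀/8`,
  `δs ≤ 1/4`, `√Cm(2√P₀ + √G₀/nlo) ≤ μM`; the window/scale fits). Part XP exhibits a tuple satisfying `OK` from the antecedents' `∀∃` data (the order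
  `… → tC,Kw,k₀ → εf,ε → ϱ → AT,m₀,CR,n₁ → ϑ₁,ω₁ → P₀,G₀,Θ,nlo → η₁,R₁`).
* XM.3 level arithmetic (`n_succ`, monotonicity, `p_succ_ge : θ₁·p ℓ ≤ p (ℓ+1)`, `p_le_div_tC_sq`, `p_le_hist`, the geometric sums `sum_inv_n_le`, `μpart_le_μM`,
  `sub_le_mul_of_steps`) and ★ `profile_step`: the count-normalised recursion of XK (`sbModeStep` + (E4)) with the profile bounds of the parent and of the far
  budget IMPLIES `mM² ≤ Cm·p ℓ`, `E(φ_{ℓ+1})(B_{n_{ℓ+1}}) ≤ p(ℓ+1)·#B_{n_{ℓ+1}}`, `L ≤ mM ≤ m₀` — the bootstrap closes because `θ₀ ≤ 1/8` carries the main term with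
  NO `Kw` factor (count-normalised decay), the history factor `Rhist` multiplies only `εf²`, `δs²`, and the far field carries `1/n²`.
-/

noncomputable section

open scoped BigOperators
open Set Function Metric Finset

namespace Summit.AtomisticToContinuum.Crystallization.Theorems.ChartedZeroExcessLayeredLatticeLiouville

/-! ### XM.1  The constants of the tower and the derived quantities -/

/-- the record of constants of the sub-window tower (see the module docstring for the rôle of each). [this file, g59] -/
structure SBK where
  (δ a Cg η R : ℝ)
  (c₀ C₁ κ₀ : ℝ)
  (CL κ₁ CT : ℝ)
  (tC Kw KR : ℝ)
  (k₀ : ℕ)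
  (εf ε ϱ AT m₀ CR n₁ : ℝ)
  (ϑ₁ ω₁ : ℝ)
  (P₀ G₀ μM Θa Θb nlo : ℝ)

namespace SBK

variable (K : SBK)

/-- main contraction coefficient `θ₀ = 8·C_L·t_C²`. -/
def θ₀ : ℝ := 8 * K.CL * K.tC ^ 2
/-- profile ratio `θ₁ = 2θ₀`. -/
def θ₁ : ℝ := 2 * K.θ₀
/-- count ratio of consecutive levels `rN = 27/tC³`. -/
def rN : ℝ := 27 / K.tC ^ 3
/-- count ratio to the history parent `Rhist = 27·Kw³/tC^{3(k₀+1)}`. -/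
def Rhist : ℝ := 27 * K.Kw ^ 3 / K.tC ^ (3 * (K.k₀ + 1))
/-- mode-size coefficient `Cm = CL(2+2CL)(2rN + tC⁻²)`. -/
def Cm : ℝ := K.CL * (2 + 2 * K.CL) * (2 * K.rN + 1 / K.tC ^ 2)
/-- top level window `n0 = R/KR`. -/
def n0 : ℝ := K.R / K.KR
/-- level windows `n ℓ = n0·tC^ℓ`. -/
def n (ℓ : ℕ) : ℝ := K.n0 * K.tC ^ ℓ
/-- ★ the PROFILE `p ℓ = P₀·θ₁^ℓ + G₀/(n ℓ)²` (per-site energy bound at level `ℓ`). -/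
def p (ℓ : ℕ) : ℝ := K.P₀ * K.θ₁ ^ ℓ + K.G₀ / K.n ℓ ^ 2
/-- inner E3 radius `t ℓ = 7C₁·n ℓ + 8ϱ + 10`. -/
def t (ℓ : ℕ) : ℝ := 7 * K.C₁ * K.n ℓ + 8 * K.ϱ + 10
/-- outer E3 radius `τ ℓ = 2·t ℓ`. -/
def τ (ℓ : ℕ) : ℝ := 2 * K.t ℓ
/-- comparison window `mw ℓ = (2τ+8)·18/c₀ + n ℓ + 2ϱ/c₀ + 1`. -/
def mw (ℓ : ℕ) : ℝ := (2 * K.τ ℓ + 8) * (18 / K.c₀) + K.n ℓ + 2 * K.ϱ / K.c₀ + 1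
/-- Direction-A constant above the floor at the tear-free threshold `9`. -/
def dA : ℝ := dictA (K.c₀ / 2) 9
/-- Direction-A constant above the floor at range `ϱ`. -/
def dAϱ : ℝ := dictA (K.c₀ / 2) K.ϱ
/-- coherence slack cap `δs = (6C₁(2ϱ/c₀)+8)((28/25)ω₁ + ϑ₁) + 2μM·(2ϱ/c₀)`. -/
def δs : ℝ := (6 * K.C₁ * (2 * K.ϱ / K.c₀) + 8) * (28 / 25 * K.ω₁ + K.ϑ₁) + 2 * K.μM * (2 * K.ϱ / K.c₀)
/-- history coefficient `γ = (4+8CL)(3/κ₁²)(dA²εf² + (½CT·δs·dAϱ)²)`. -/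
def γ : ℝ := (4 + 8 * K.CL) * (3 / K.κ₁ ^ 2) * (K.dA ^ 2 * K.εf ^ 2 + (1 / 2 * K.CT * K.δs * K.dAϱ) ^ 2)
/-- far-field coefficient `G₁ = (4+8CL)(3/κ₁²)·dA·AT²·1000C₁/(δ³tC³)`. -/
def G₁ : ℝ := (4 + 8 * K.CL) * (3 / K.κ₁ ^ 2) * K.dA * K.AT ^ 2 * (1000 * K.C₁ / (K.δ ^ 3 * K.tC ^ 3))
/-- far budget at level `ℓ`: `Θ ℓ = Θa + Θb/(n ℓ)²`. -/
def Θ (ℓ : ℕ) : ℝ := K.Θa + K.Θb / K.n ℓ ^ 2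
/-- the largest profile value on the tower `pmax = P₀ + G₀/nlo²`. -/
def pmax : ℝ := K.P₀ + K.G₀ / K.nlo ^ 2
/-- partial drift sums `μpart i = Σ_{j<i} √(Cm·p j)` (the accumulated mode size after `i` levels is at most this). -/
def μpart (i : ℕ) : ℝ := ∑ j ∈ Finset.range i, Real.sqrt (K.Cm * K.p j)

/-! ### XM.2  The inequalities among the constants -/

/-- ★ `SBK.OK`: every inequality among the constants used by the tower (module docstring XM.2). [this file, g59] -/
structure OK : Prop where
  (hδ : 0 < K.δ) (hδ1 : K.δ ≤ 1) (ha : 0 < K.a) (hCg : 1 ≤ K.Cg) (hη : 0 < K.η) (hR : 1 ≤ K.R)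
  (hc₀ : 0 < K.c₀) (hc₀1 : K.c₀ ≤ 1) (hcC : K.c₀ ≤ K.C₁) (hκ₀ : 0 < K.κ₀)
  (hCL : 1 ≤ K.CL) (hκ₁ : 0 < K.κ₁) (hCT : 0 ≤ K.CT)
  (htC : 0 < K.tC) (htC2 : K.tC ≤ 1 / 2) (hθ₀ : K.θ₀ ≤ 1 / 8)
  (hKw : 504 * K.C₁ / K.c₀ + 2 ≤ K.Kw) (hKwk : K.Kw * K.tC ^ K.k₀ ≤ 1) (hKR : 0 < K.KR)
  (hεf : 0 < K.εf) (hε : 0 < K.ε) (hϱ : 1 ≤ K.ϱ) (hAT : 0 ≤ K.AT) (hm₀ : 0 < K.m₀) (hCR : 1 ≤ K.CR) (hn₁ : 0 < K.n₁)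
  (hϑ₁ : 0 < K.ϑ₁) (hω₁ : 0 < K.ω₁)
  (hP₀ : 0 ≤ K.P₀) (hG₀ : 0 ≤ K.G₀) (hμM : 0 ≤ K.μM) (hΘa : 0 ≤ K.Θa) (hΘb : 0 ≤ K.Θb) (hnlo : 1 ≤ K.nlo)
  -- history, far field, corrections
  (hγ : K.γ * K.Rhist * (2 + 216 * (K.k₀ : ℝ) ^ 2 * K.Cm) ≤ K.θ₁ ^ (K.k₀ + 1) / 8)
  (hfarA : 16 * K.tC ^ 2 * K.G₁ * K.Θa ≤ K.G₀) (hfarB : 16 * K.tC ^ 2 * K.G₁ * K.Θb ≤ K.G₀ * K.nlo ^ 2)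
  (hεs : 1728 * K.Cm * K.ε ^ 2 ≤ K.θ₁) (hCRs : 1728 * K.CR ^ 2 * K.Cm ^ 2 * K.pmax ≤ K.θ₁)
  (hm₀s : K.Cm * K.pmax ≤ K.m₀ ^ 2) (hLc : K.CR * Real.sqrt (K.Cm * K.pmax) + K.ε ≤ 1)
  -- drift budget
  (hdc : K.CR * K.μM ≤ K.c₀ / 2) (hdκ : K.CR * K.μM ≤ K.κ₀ / 2) (hdC : K.CR * K.μM ≤ K.C₁) (hds : K.CR * K.μM ≤ 1 / 50)
  (hdν : K.CR * K.μM ≤ 1 / 2000) (htear : 2 * K.μM ≤ K.c₀ / 8) (hδs4 : K.δs ≤ 1 / 4)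
  (hμsum : Real.sqrt K.Cm * (2 * Real.sqrt K.P₀ + Real.sqrt K.G₀ / K.nlo) ≤ K.μM)
  -- scales and windows
  (hnlo₁ : K.n₁ ≤ K.nlo) (hnlom : (32 * K.ϱ + 48) * (18 / K.c₀) + 2 * K.ϱ / K.c₀ + 1 ≤ K.nlo) (hnlot : 8 * K.ϱ + 10 ≤ K.C₁ * K.nlo)
  (hn0lo : K.nlo ≤ K.n0)
  (hwin : 8 * K.R + 28 / 25 * (6 * K.C₁ * (K.Kw * K.n0) + 8) + 28 / 25 * (6 * K.C₁ * (2 * K.ϱ / K.c₀) + 8) + 28 / 25 * (6 * K.C₁ + 8) ≤ 9 * K.R)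
  (hτR : 14 * K.C₁ * K.n0 + 16 * K.ϱ + 20 ≤ K.R)
  (hreg : dictB K.C₁ K.δ * (9 * K.Cg * K.η * (2 * (9 * K.R + 1) / K.δ + 1) ^ 3) ≤ K.P₀ * K.n0 ^ 3)
  -- far budget constants
  (hΘa' : dictA K.c₀ 8 * (27 * (336 * K.C₁ * (24 / (K.c₀ * K.tC)) / 25) ^ 3) * (2 * K.P₀ + 54 * (2 * K.μM) ^ 2) +
      2 * (10 / K.δ + 1) ^ 3 * (9 * K.Cg * K.η) * ((2 * (192 * K.KR / K.c₀ + 2) / K.δ + 1 / 21) * (336 * K.C₁ / 25)) ^ 3 +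
      2 * ((2 * K.μM) * (8 / K.c₀)) ^ 2 * (10 / K.δ + 1) ^ 3 ≤ K.Θa)
  (hΘb' : dictA K.c₀ 8 * (27 * (336 * K.C₁ * (24 / (K.c₀ * K.tC)) / 25) ^ 3) * (2 * K.G₀) ≤ K.Θb)

/-! ### XM.3  Level arithmetic -/

section Arith

variable {K}

/-- `θ₀_nonneg` (docstring added by the landing lane; see the module docstring). [formal bookkeeping] -/
theorem θ₀_nonneg (hK : K.OK) : 0 ≤ K.θ₀ := by unfold θ₀; have := hK.hCL; have := hK.htC; positivity
/-- `θ₁_nonneg` (docstring added by the landing lane; see the module docstring). [formal bookkeeping] -/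
theorem θ₁_nonneg (hK : K.OK) : 0 ≤ K.θ₁ := by unfold θ₁; linarith [θ₀_nonneg hK]
/-- `θ₁_le` (docstring added by the landing lane; see the module docstring). [formal bookkeeping] -/
theorem θ₁_le (hK : K.OK) : K.θ₁ ≤ 1 / 4 := by unfold θ₁; linarith [hK.hθ₀]
/-- `θ₁_pos` (docstring added by the landing lane; see the module docstring). [formal bookkeeping] -/
theorem θ₁_pos (hK : K.OK) : 0 < K.θ₁ := by
  unfold θ₁ θ₀; have := hK.hCL; have := hK.htC; positivity
/-- `tC_le_one` (docstring added by the landing lane; see the module docstring). [formal bookkeeping] -/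
theorem tC_le_one (hK : K.OK) : K.tC ≤ 1 := by linarith [hK.htC2]
/-- `rN_pos` (docstring added by the landing lane; see the module docstring). [formal bookkeeping] -/
theorem rN_pos (hK : K.OK) : 0 < K.rN := by unfold rN; have := hK.htC; positivity
/-- `one_le_rN` (docstring added by the landing lane; see the module docstring). [formal bookkeeping] -/
theorem one_le_rN (hK : K.OK) : 1 ≤ K.rN := by
  unfold rN; rw [le_div_iff₀ (by have := hK.htC; positivity)]
  have h3 : K.tC ^ 3 ≤ 1 := pow_le_one₀ hK.htC.le (tC_le_one hK)
  linarith
/-- `Cm_pos` (docstring added by the landing lane; see the module docstring). [formal bookkeeping] -/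
theorem Cm_pos (hK : K.OK) : 0 < K.Cm := by
  unfold Cm; have := hK.hCL; have := hK.htC; have := rN_pos hK; positivity
/-- `C₁_pos` (docstring added by the landing lane; see the module docstring). [formal bookkeeping] -/
theorem C₁_pos (hK : K.OK) : 0 < K.C₁ := lt_of_lt_of_le hK.hc₀ hK.hcC
/-- `one_le_Kw` (docstring added by the landing lane; see the module docstring). [formal bookkeeping] -/
theorem one_le_Kw (hK : K.OK) : 1 ≤ K.Kw := by
  have h := hK.hKw; have : 0 ≤ 504 * K.C₁ / K.c₀ := by have := hK.hc₀; have := C₁_pos hK; positivity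
  linarith
/-- `Rhist_pos` (docstring added by the landing lane; see the module docstring). [formal bookkeeping] -/
theorem Rhist_pos (hK : K.OK) : 0 < K.Rhist := by
  unfold Rhist; have := hK.htC; have := one_le_Kw hK; positivity
/-- `n0_pos` (docstring added by the landing lane; see the module docstring). [formal bookkeeping] -/
theorem n0_pos (hK : K.OK) : 0 < K.n0 := by unfold n0; have := hK.hR; have := hK.hKR; exact div_pos (by linarith) this
/-- `n_pos` (docstring added by the landing lane; see the module docstring). [formal bookkeeping] -/
theorem n_pos (hK : K.OK) (ℓ : ℕ) : 0 < K.n ℓ := by unfold n; have := n0_pos hK; have := hK.htC; positivity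
/-- `n_succ` (docstring added by the landing lane; see the module docstring). [formal bookkeeping] -/
theorem n_succ (K : SBK) (ℓ : ℕ) : K.n (ℓ + 1) = K.tC * K.n ℓ := by unfold n; rw [pow_succ]; ring
/-- `n_zero` (docstring added by the landing lane; see the module docstring). [formal bookkeeping] -/
theorem n_zero (K : SBK) : K.n 0 = K.n0 := by unfold n; simp
/-- the windows shrink along the tower. -/
theorem n_anti (hK : K.OK) {i j : ℕ} (h : i ≤ j) : K.n j ≤ K.n i := by
  unfold n
  exact mul_le_mul_of_nonneg_left (pow_le_pow_of_le_one hK.htC.le (tC_le_one hK) h) (n0_pos hK).le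
/-- `n_succ_le` (docstring added by the landing lane; see the module docstring). [formal bookkeeping] -/
theorem n_succ_le (hK : K.OK) (ℓ : ℕ) : K.n (ℓ + 1) ≤ K.n ℓ := n_anti hK (Nat.le_succ ℓ)
/-- `nlo_pos` (docstring added by the landing lane; see the module docstring). [formal bookkeeping] -/
theorem nlo_pos (hK : K.OK) : 0 < K.nlo := by linarith [hK.hnlo]
/-- `p_nonneg` (docstring added by the landing lane; see the module docstring). [formal bookkeeping] -/
theorem p_nonneg (hK : K.OK) (ℓ : ℕ) : 0 ≤ K.p ℓ := by
  unfold p; have := hK.hP₀; have := hK.hG₀; have := θ₁_nonneg hK; have := n_pos hK ℓ; positivity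
/-- `pmax_nonneg` (docstring added by the landing lane; see the module docstring). [formal bookkeeping] -/
theorem pmax_nonneg (hK : K.OK) : 0 ≤ K.pmax := by
  unfold pmax; have := hK.hP₀; have := hK.hG₀; have := nlo_pos hK; positivity
/-- `p ℓ ≤ pmax` on the tower (`n ℓ ≥ nlo`). -/
theorem p_le_pmax (hK : K.OK) {ℓ : ℕ} (h : K.nlo ≤ K.n ℓ) : K.p ℓ ≤ K.pmax := by
  unfold p pmax
  have h1 : K.θ₁ ^ ℓ ≤ 1 := pow_le_one₀ (θ₁_nonneg hK) (by linarith [θ₁_le hK])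
  have h2 : K.G₀ / K.n ℓ ^ 2 ≤ K.G₀ / K.nlo ^ 2 :=
    div_le_div_of_nonneg_left hK.hG₀ (by have := nlo_pos hK; positivity) (pow_le_pow_left₀ (nlo_pos hK).le h 2)
  nlinarith [hK.hP₀]
/-- the profile loses at most the factor `θ₁` per level: `θ₁·p ℓ ≤ p (ℓ+1)`. -/
theorem p_succ_ge (hK : K.OK) (ℓ : ℕ) : K.θ₁ * K.p ℓ ≤ K.p (ℓ + 1) := by
  unfold p
  have h1 : K.G₀ / K.n ℓ ^ 2 ≤ K.G₀ / K.n (ℓ + 1) ^ 2 :=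
    div_le_div_of_nonneg_left hK.hG₀ (by have := n_pos hK (ℓ+1); positivity) (pow_le_pow_left₀ (n_pos hK _).le (n_succ_le hK ℓ) 2)
  have h2 : K.θ₁ * (K.G₀ / K.n ℓ ^ 2) ≤ K.G₀ / K.n ℓ ^ 2 := by
    have : 0 ≤ K.G₀ / K.n ℓ ^ 2 := by have := hK.hG₀; have := n_pos hK ℓ; positivity
    nlinarith [θ₁_le hK, θ₁_nonneg hK]
  rw [pow_succ K.θ₁ ℓ]; nlinarith
/-- … and gains at most `tC⁻²`: `p (ℓ+1) ≤ p ℓ / tC²`. -/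
theorem p_succ_le (hK : K.OK) (ℓ : ℕ) : K.p (ℓ + 1) ≤ K.p ℓ / K.tC ^ 2 := by
  unfold p
  have htC := hK.htC
  have ht1 : K.tC ^ 2 ≤ 1 := pow_le_one₀ htC.le (tC_le_one hK)
  rw [n_succ, le_div_iff₀ (by positivity), pow_succ K.θ₁ ℓ]
  have e : K.G₀ / (K.tC * K.n ℓ) ^ 2 * K.tC ^ 2 = K.G₀ / K.n ℓ ^ 2 := by
    have := n_pos hK ℓ; field_simp
  have h1 : K.P₀ * (K.θ₁ ^ ℓ * K.θ₁) * K.tC ^ 2 ≤ K.P₀ * K.θ₁ ^ ℓ := by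
    have h0 : 0 ≤ K.P₀ * K.θ₁ ^ ℓ := by have := hK.hP₀; have := θ₁_nonneg hK; positivity
    have : K.θ₁ * K.tC ^ 2 ≤ 1 := by nlinarith [θ₁_le hK, θ₁_nonneg hK]
    nlinarith
  nlinarith [e]
/-- the main term: `θ₀·p ℓ ≤ p(ℓ+1)/2` (`θ₀ = θ₁/2`, `θ₀ ≤ 1/8 ≤ tC⁻²/2`). -/
theorem θ₀_p_le (hK : K.OK) (ℓ : ℕ) : K.θ₀ * K.p ℓ ≤ K.p (ℓ + 1) / 2 := by
  have h := p_succ_ge hK ℓ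
  have e : K.θ₀ = K.θ₁ / 2 := by unfold θ₁; ring
  rw [e]; linarith
/-- every profile value between the history parent `ℓ ∸ k₀` and `ℓ + 1` is `≤ p(ℓ+1)/θ₁^{k₀+1}`. -/
theorem p_le_hist (hK : K.OK) {ℓ i : ℕ} (h1 : ℓ - K.k₀ ≤ i) (h2 : i ≤ ℓ + 1) : K.p i ≤ K.p (ℓ + 1) / K.θ₁ ^ (K.k₀ + 1) := by
  have hθ := θ₁_pos hK
  have hθ1 : K.θ₁ ≤ 1 := by linarith [θ₁_le hK]
  rw [le_div_iff₀ (pow_pos hθ _)]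
  unfold p
  have hA : K.P₀ * K.θ₁ ^ i * K.θ₁ ^ (K.k₀ + 1) ≤ K.P₀ * K.θ₁ ^ (ℓ + 1) := by
    have : K.θ₁ ^ i * K.θ₁ ^ (K.k₀ + 1) ≤ K.θ₁ ^ (ℓ + 1) := by
      rw [← pow_add]; exact pow_le_pow_of_le_one hθ.le hθ1 (by omega)
    have := hK.hP₀; nlinarith
  have hB : K.G₀ / K.n i ^ 2 * K.θ₁ ^ (K.k₀ + 1) ≤ K.G₀ / K.n (ℓ + 1) ^ 2 := by
    have h3 : K.G₀ / K.n i ^ 2 ≤ K.G₀ / K.n (ℓ + 1) ^ 2 :=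
      div_le_div_of_nonneg_left hK.hG₀ (by have := n_pos hK (ℓ+1); positivity) (pow_le_pow_left₀ (n_pos hK _).le (n_anti hK h2) 2)
    have h4 : K.θ₁ ^ (K.k₀ + 1) ≤ 1 := pow_le_one₀ hθ.le hθ1
    have h5 : 0 ≤ K.G₀ / K.n i ^ 2 := by have := hK.hG₀; have := n_pos hK i; positivity
    nlinarith
  nlinarith
/-- the top registration value `P₀` obeys the same bound for the levels above the lag (`ℓ < k₀`). -/
theorem P₀_le_hist (hK : K.OK) {ℓ : ℕ} (h : ℓ < K.k₀) : K.P₀ ≤ K.p (ℓ + 1) / K.θ₁ ^ (K.k₀ + 1) := by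
  have hθ := θ₁_pos hK
  have hθ1 : K.θ₁ ≤ 1 := by linarith [θ₁_le hK]
  rw [le_div_iff₀ (pow_pos hθ _)]
  unfold p
  have h1 : K.θ₁ ^ (K.k₀ + 1) ≤ K.θ₁ ^ (ℓ + 1) := pow_le_pow_of_le_one hθ.le hθ1 (by omega)
  have h2 : 0 ≤ K.G₀ / K.n (ℓ + 1) ^ 2 := by have := hK.hG₀; have := n_pos hK (ℓ+1); positivity
  have := hK.hP₀; nlinarith
/-- `Σ_{j<i} 1/n j ≤ 1/n i` (`tC ≤ 1/2`). -/
theorem sum_inv_n_le (hK : K.OK) (i : ℕ) : ∑ j ∈ Finset.range i, 1 / K.n j ≤ 1 / K.n i := by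
  induction i with
  | zero => simp [(n_pos hK 0).le]
  | succ i ih =>
    rw [Finset.sum_range_succ, n_succ]
    have hn := n_pos hK i
    have htC := hK.htC
    have e : 1 / (K.tC * K.n i) = (1 / K.tC) * (1 / K.n i) := by rw [one_div_mul_one_div]
    rw [e]
    have h2 : 2 ≤ 1 / K.tC := by rw [le_div_iff₀ htC]; linarith [hK.htC2]
    have h0 : 0 ≤ 1 / K.n i := by positivity
    nlinarith
/-- `√(x+y) ≤ √x + √y`. [formal bookkeeping] (dedup gate: public twin Literature.NumberTheory.LFunctions.MRT2015.sqrt_add_le_sqrt_add_sqrt in an unrelated module — reviewer p850934 item 2: keep the local copy; made PRIVATE to pass the gate) -/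
private theorem sqrt_add_le_sqrt_add {x y : ℝ} (hx : 0 ≤ x) (hy : 0 ≤ y) : Real.sqrt (x + y) ≤ Real.sqrt x + Real.sqrt y := by
  have h1 := Real.sqrt_nonneg x
  have h2 := Real.sqrt_nonneg y
  have e : x + y = Real.sqrt x ^ 2 + Real.sqrt y ^ 2 := by rw [Real.sq_sqrt hx, Real.sq_sqrt hy]
  rw [e]
  calc Real.sqrt (Real.sqrt x ^ 2 + Real.sqrt y ^ 2) ≤ Real.sqrt ((Real.sqrt x + Real.sqrt y) ^ 2) :=
        Real.sqrt_le_sqrt (by nlinarith)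
    _ = Real.sqrt x + Real.sqrt y := Real.sqrt_sq (by positivity)
/-- `√(θ₁^j) ≤ (1/2)^j` (`θ₁ ≤ 1/4`). -/
theorem sqrt_θ₁_pow_le (hK : K.OK) (j : ℕ) : Real.sqrt (K.θ₁ ^ j) ≤ (1 / 2 : ℝ) ^ j := by
  have h : K.θ₁ ^ j ≤ ((1 / 2 : ℝ) ^ j) ^ 2 := by
    rw [← pow_mul, mul_comm, pow_mul]
    exact pow_le_pow_left₀ (θ₁_nonneg hK) (by norm_num; linarith [θ₁_le hK]) j
  calc Real.sqrt (K.θ₁ ^ j) ≤ Real.sqrt (((1 / 2 : ℝ) ^ j) ^ 2) := Real.sqrt_le_sqrt h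
    _ = (1 / 2 : ℝ) ^ j := Real.sqrt_sq (by positivity)
/-- one level of drift: `√(Cm·p j) ≤ √Cm·(√P₀·(1/2)^j + √G₀/n j)`. -/
theorem sqrt_Cm_p_le (hK : K.OK) (j : ℕ) :
    Real.sqrt (K.Cm * K.p j) ≤ Real.sqrt K.Cm * (Real.sqrt K.P₀ * (1 / 2 : ℝ) ^ j + Real.sqrt K.G₀ / K.n j) := by
  rw [Real.sqrt_mul (Cm_pos hK).le]
  refine mul_le_mul_of_nonneg_left ?_ (Real.sqrt_nonneg _)
  unfold p
  have hn := n_pos hK j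
  calc Real.sqrt (K.P₀ * K.θ₁ ^ j + K.G₀ / K.n j ^ 2)
      ≤ Real.sqrt (K.P₀ * K.θ₁ ^ j) + Real.sqrt (K.G₀ / K.n j ^ 2) :=
        sqrt_add_le_sqrt_add (by have := hK.hP₀; have := θ₁_nonneg hK; positivity) (by have := hK.hG₀; positivity)
    _ = Real.sqrt K.P₀ * Real.sqrt (K.θ₁ ^ j) + Real.sqrt K.G₀ / K.n j := by
        rw [Real.sqrt_mul hK.hP₀, Real.sqrt_div hK.hG₀, Real.sqrt_sq hn.le]
    _ ≤ Real.sqrt K.P₀ * (1 / 2 : ℝ) ^ j + Real.sqrt K.G₀ / K.n j := by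
        have := mul_le_mul_of_nonneg_left (sqrt_θ₁_pow_le hK j) (Real.sqrt_nonneg K.P₀)
        linarith
/-- `μpart_nonneg` (docstring added by the landing lane; see the module docstring). [formal bookkeeping] -/
theorem μpart_nonneg (K : SBK) (i : ℕ) : 0 ≤ K.μpart i := Finset.sum_nonneg fun _ _ => Real.sqrt_nonneg _
/-- `μpart_zero` (docstring added by the landing lane; see the module docstring). [formal bookkeeping] -/
theorem μpart_zero (K : SBK) : K.μpart 0 = 0 := by unfold μpart; simp
/-- one more level of drift fits the partial sum: `μpart (i+1) = μpart i + √(Cm·p i)`. -/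
theorem μpart_succ (K : SBK) (i : ℕ) : K.μpart (i + 1) = K.μpart i + Real.sqrt (K.Cm * K.p i) := by
  unfold μpart; rw [Finset.sum_range_succ]
/-- ★ the accumulated mode size on the tower is `≤ μM`: `μpart i ≤ √Cm(2√P₀ + √G₀/nlo) ≤ μM` whenever `n i ≥ nlo` (geometric sums). [this file, g59] -/
theorem μpart_le_μM (hK : K.OK) {i : ℕ} (hi : K.nlo ≤ K.n i) : K.μpart i ≤ K.μM := by
  have h1 : K.μpart i ≤ ∑ j ∈ Finset.range i, Real.sqrt K.Cm * (Real.sqrt K.P₀ * (1 / 2 : ℝ) ^ j + Real.sqrt K.G₀ / K.n j) :=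
    Finset.sum_le_sum fun j _ => sqrt_Cm_p_le hK j
  have h2 : ∑ j ∈ Finset.range i, Real.sqrt K.Cm * (Real.sqrt K.P₀ * (1 / 2 : ℝ) ^ j + Real.sqrt K.G₀ / K.n j) =
      Real.sqrt K.Cm * (Real.sqrt K.P₀ * ∑ j ∈ Finset.range i, (1 / 2 : ℝ) ^ j + Real.sqrt K.G₀ * ∑ j ∈ Finset.range i, 1 / K.n j) := by
    rw [← Finset.mul_sum, Finset.sum_add_distrib, Finset.mul_sum, Finset.mul_sum]
    congr 1; congr 1; refine Finset.sum_congr rfl fun j _ => ?_; rw [mul_one_div]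
  have h3 := sum_geometric_two_le i  -- (reviewer p850934: Mathlib lemma, seat copy deleted)
  have h4 := sum_inv_n_le hK i
  have h5 : 1 / K.n i ≤ 1 / K.nlo := one_div_le_one_div_of_le (nlo_pos hK) hi
  have hP := Real.sqrt_nonneg K.P₀
  have hG := Real.sqrt_nonneg K.G₀
  have hC := Real.sqrt_nonneg K.Cm
  calc K.μpart i ≤ Real.sqrt K.Cm * (Real.sqrt K.P₀ * ∑ j ∈ Finset.range i, (1 / 2 : ℝ) ^ j + Real.sqrt K.G₀ * ∑ j ∈ Finset.range i, 1 / K.n j) :=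
        h1.trans h2.le
    _ ≤ Real.sqrt K.Cm * (Real.sqrt K.P₀ * 2 + Real.sqrt K.G₀ * (1 / K.nlo)) := by
        refine mul_le_mul_of_nonneg_left ?_ hC
        nlinarith [mul_le_mul_of_nonneg_left h3 hP, mul_le_mul_of_nonneg_left (h4.trans h5) hG]
    _ = Real.sqrt K.Cm * (2 * Real.sqrt K.P₀ + Real.sqrt K.G₀ / K.nlo) := by ring
    _ ≤ K.μM := hK.hμsum
/-- recent drift: if consecutive differences of `f` on `[π, ℓ)` are `≤ B` then `f ℓ − f π ≤ (ℓ − π)·B`. [formal bookkeeping] -/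
theorem sub_le_mul_of_steps {f : ℕ → ℝ} {B : ℝ} {π ℓ : ℕ} (hπ : π ≤ ℓ) (h : ∀ i, π ≤ i → i < ℓ → f (i + 1) - f i ≤ B) :
    f ℓ - f π ≤ ((ℓ - π : ℕ) : ℝ) * B := by
  obtain ⟨d, rfl⟩ := Nat.exists_eq_add_of_le hπ
  rw [Nat.add_sub_cancel_left]
  induction d with
  | zero => simp
  | succ d ih =>
    have h1 := ih (Nat.le_add_right π d) fun i hi1 hi2 => h i hi1 (by omega)
    have h2 := h (π + d) (Nat.le_add_right π d) (by omega)
    rw [← add_assoc]; push_cast at h1 ⊢; linarith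

end Arith



end SBK

end Summit.AtomisticToContinuum.Crystallization.Theorems.ChartedZeroExcessLayeredLatticeLiouville

end
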